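import Literature.Computability.ImplicitComplexity.STAEncStep
import HarnessLib

/-!
# GMR08 completeness infrastructure, VIII: typing the transition term

Support file 8 for the completeness half of
`Literature.Computability.ImplicitComplexity.STACapturesP` (GMR08 Thm. 3.9): the "boring but
easy" (GMR) verification that the transition term is typable with a type of the form
`Conf ⊸ Conf` ("`⊢ Tr : ATM_i ⊸ ATM_i` for every `i`"), here
`Conf ≐ ∀α.!^{m₁}X ⊸ !^{p₂}X ⊸ (St^{nK+1} ⊗ E_{H+1})` for every pair of levels `m₁, p₂` of the two
cell constructors, in the zone form `HTz` of `STAEncZone` (so that `Step` can sit at the core of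
the string-driven iterator of `STAEncIter`). Ingredients: closed branches
`brGoto / brPush / brPop : Dst ⊸ ⋯ ⊸ Dst ⊸ St^{nK+1} ⊗ E_{H+1}` (`HTz.brInstr`), the
continuation `HTz.stepBody`, and the type bookkeeping (`Conf` is closed, `Conf_rename`; its body
instantiated at `Dst`, `confBody_inst`).

## References

* [GaboardiMarionRonchidellarocca2008] GMR08 §3.2, Thm. 3.9; M. Gaboardi, J.-Y. Marion,
  S. Ronchi Della Rocca, ACM TOCL 13 (2012) §5 ("It is boring but easy to check that the term
  `Dec` can be typed …", "`Com : ID_i ⊸ ATM_i`").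
-/

namespace Literature.Computability.ImplicitComplexity

namespace STA

/-! ### Type-level lemmas -/

/-- `arrows_replicate_rename` (bookkeeping). [folklore] -/
theorem LinTy.arrows_replicate_rename (n : ℕ) (τ : SoftTy) (A : LinTy) (ρ : ℕ → ℕ) :
    (LinTy.arrows (List.replicate n τ) A).rename ρ = LinTy.arrows (List.replicate n (τ.renameT ρ)) (A.rename ρ) := by
  induction n with
  | zero => rfl
  | succ n ih => simp [List.replicate_succ, LinTy.arrows, LinTy.rename, ih, SoftTy.renameT]

/-- `arrows_map_rename` (bookkeeping). [folklore] -/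
theorem LinTy.arrows_map_rename {ι : Type} (l : List ι) (f : ι → SoftTy) (A : LinTy) (ρ : ℕ → ℕ) :
    (LinTy.arrows (l.map f) A).rename ρ = LinTy.arrows (l.map fun x => (f x).renameT ρ) (A.rename ρ) := by
  induction l with
  | nil => rfl
  | cons x l ih => simp [LinTy.arrows, LinTy.rename, ih, SoftTy.renameT]

/-- `E_n` is closed. [folklore] -/
theorem tyE_rename (n : ℕ) (ρ : ℕ → ℕ) : (tyE n).rename ρ = tyE n := by
  simp [tyE, LinTy.rename, LinTy.arrows_replicate_rename, SoftTy.renameT, liftRen]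

/-- `tyE_substp` (bookkeeping). [folklore] -/
theorem tyE_substp (n : ℕ) (θ : ℕ → LinTy) : (tyE n).substp θ = tyE n := by
  simp [tyE, LinTy.substp, LinTy.arrows_replicate_substp, SoftTy.substT]

/-- Renaming an `n`-ary tensor type. [folklore] -/
theorem tyTensN_rename (As : List LinTy) (ρ : ℕ → ℕ) :
    (tyTensN As).rename ρ = tyTensN (As.map fun A => A.rename ρ) := by
  simp only [tyTensN, LinTy.rename, LinTy.arrows_map_rename, List.map_map, liftRen, SoftTy.renameT]
  congr 3
  refine List.map_congr_left fun A _ => ?_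
  simp [Function.comp_apply, LinTy.rename_liftRen_rename_succ]

/-- Substituting in an `n`-ary tensor type. [folklore] -/
theorem tyTensN_substp (As : List LinTy) (θ : ℕ → LinTy) :
    (tyTensN As).substp θ = tyTensN (As.map fun A => A.substp θ) := by
  simp only [tyTensN, LinTy.substp, LinTy.arrows_map_substp, List.map_map, LinTy.up, SoftTy.substT]
  congr 3
  refine List.map_congr_left fun A _ => ?_
  simp [Function.comp_apply, LinTy.substp_up_rename_succ]

namespace Sim

variable (NS nK : ℕ)

/-- `St^{nK+1} ⊗ E_{H+1}`: the body of a configuration. [cite: GaboardiMarionRonchidellarocca2008, §3.2] -/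
def BodyT (H : ℕ) : LinTy := tyTensN (List.replicate (nK + 1) St ++ [tyE (H + 1)])

/-- **`Conf ≐ ∀α.!^{m₁}X ⊸ !^{p₂}X ⊸ (St^{nK+1} ⊗ E_{H+1})`** (GMR's `ATM_i`, with two cell
constructors and `nK + 1` stacks). [cite: GaboardiMarionRonchidellarocca2008, §3.2] -/
def Conf (H m₁ p₂ : ℕ) : LinTy := .all (.limp m₁ (X NS) (.limp p₂ (X NS) (BodyT nK H)))

/-- `X` at the result type `D`: `Sym ⊸ D ⊸ D`. [folklore] -/
def XD (D : LinTy) : LinTy := .limp 0 (SymT NS) (.limp 0 D D)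

/-- The body type at the result type `D`. [folklore] -/
def BodyTD (H : ℕ) (D : LinTy) : LinTy := tyTensN (List.replicate (nK + 1) (.limp 0 D D) ++ [tyE (H + 1)])

/-- The type of the branches `Dst ⊸ ⋯ ⊸ Dst ⊸ St^{nK+1} ⊗ E_{H+1}`. [folklore] -/
def BrR (H : ℕ) : LinTy := LinTy.arrows (List.replicate (nK + 1) ⟨0, Dst NS⟩) (BodyT nK H)

variable {NS nK}

/-- `SymT_rename` (bookkeeping). [folklore] -/
theorem SymT_rename (ρ : ℕ → ℕ) : (SymT NS).rename ρ = SymT NS := tyE_rename _ _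
/-- `SymT_substp` (bookkeeping). [folklore] -/
theorem SymT_substp (θ : ℕ → LinTy) : (SymT NS).substp θ = SymT NS := tyE_substp _ _
/-- `St_rename_liftRen` (bookkeeping). [folklore] -/
theorem St_rename_liftRen (ρ : ℕ → ℕ) : LinTy.rename (liftRen ρ) St = St := rfl
/-- `X_rename_liftRen` (bookkeeping). [folklore] -/
theorem X_rename_liftRen (ρ : ℕ → ℕ) : (X NS).rename (liftRen ρ) = X NS := by
  simp [X, LinTy.rename, SymT_rename, St_rename_liftRen]

/-- `BodyT_rename_liftRen` (bookkeeping). [folklore] -/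
theorem BodyT_rename_liftRen (H : ℕ) (ρ : ℕ → ℕ) : (BodyT nK H).rename (liftRen ρ) = BodyT nK H := by
  rw [BodyT, tyTensN_rename]
  simp [List.map_append, List.map_replicate, St_rename_liftRen, tyE_rename]

/-- `Conf` is a closed type. [folklore] -/
theorem Conf_rename (H m₁ p₂ : ℕ) (ρ : ℕ → ℕ) : (Conf NS nK H m₁ p₂).rename ρ = Conf NS nK H m₁ p₂ := by
  simp [Conf, LinTy.rename, X_rename_liftRen, BodyT_rename_liftRen]

/-- The body of `Conf` instantiated at `D`. [folklore] -/
theorem confBody_inst (H m₁ p₂ : ℕ) (D : LinTy) :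
    (LinTy.limp m₁ (X NS) (.limp p₂ (X NS) (BodyT nK H))).inst D =
      .limp m₁ (XD NS D) (.limp p₂ (XD NS D) (BodyTD nK H D)) := by
  rw [LinTy.inst_eq_substp]
  simp only [LinTy.substp, X, XD, SymT_substp, BodyT, BodyTD, tyTensN_substp, List.map_append, List.map_replicate,
    List.map_cons, List.map_nil, tyE_substp]
  rfl

/-! ### Small typed pieces -/

section typing

variable {r m k : ℕ} {L : Ctx}

/-- `⊢ initD : Dst`. [cite: GaboardiMarionRonchidellarocca2008, §3.2] -/
theorem _root_.Literature.Computability.ImplicitComplexity.STA.HTz.initD (hr : 2 ≤ r) : HTz r m k L (initD NS) ⟨0, Dst NS⟩ := by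
  refine HTz.tuple hr (fun _ => 3) [I, dummyX, botT NS] [St, X NS, SymT NS] rfl fun j hj => ?_
  rcases j with _ | _ | _ | j
  · exact HTz.I
  · exact HTz.dummyX
  · exact HTz.botT
  · exfalso; simp at hj; omega

/-- `⊢ commitT : St ⊸ X ⊸ Sym ⊸ St`. [cite: GaboardiMarionRonchidellarocca2008, §3.2] -/
theorem _root_.Literature.Computability.ImplicitComplexity.STA.HTz.commitT (hr : 2 ≤ r) :
    HTz r m k L (commitT NS) ⟨0, LinTy.arrows [⟨0, St⟩, ⟨0, X NS⟩, ⟨0, SymT NS⟩] St⟩ := by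
  refine HTz.lamsL [⟨0, St⟩, ⟨0, X NS⟩, ⟨0, SymT NS⟩] ?_
  simp only [List.length_cons, List.length_nil, Ctx.pushL_cons, Ctx.pushL_nil]
  exact HTz.commit hr (g := 2) (h := 1) (i := 0) (by omega) (by omega) (by omega) (by omega) (by omega) (by omega)
    rfl rfl rfl

/-- A decomposed stack in a local slot, restored: `D commitT : St`. [cite: GaboardiMarionRonchidellarocca2008, §3.2] -/
theorem _root_.Literature.Computability.ImplicitComplexity.STA.HTz.restore (hr : 2 ≤ r) {d : ℕ} (hd : d < k)
    (hL : L d = some ⟨0, Dst NS⟩) : HTz r m k L (restore NS (.var d)) ⟨0, St⟩ := by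
  have h1 : HTz r m k L (.var d) ⟨0, .all (.limp 0 (LinTy.arrows ([St, X NS, SymT NS].map fun A => ⟨0, A.rename Nat.succ⟩)
      (.tvar 0)) (.tvar 0))⟩ := HTz.lvar hd (by rw [hL]; rfl)
  have h2 := h1.allE St
  rw [tyTensN_inst] at h2
  exact HTz.app hr (L₂ := fun _ => none) (fun i => Or.inl ⟨rfl, rfl⟩) h2 (HTz.commitT hr)

/-- The context `D_{n-1} : Dst, …, D₀ : Dst` of the branch binders. [folklore] -/
def ctxD (NS n : ℕ) : Ctx := fun i => if i < n then some ⟨0, Dst NS⟩ else none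

/-- `pushL_replicate_Dst` (bookkeeping). [folklore] -/
theorem pushL_replicate_Dst (n : ℕ) : Ctx.pushL (List.replicate n (⟨0, Dst NS⟩ : SoftTy)) (fun _ => none) = ctxD NS n := by
  funext i
  rw [Ctx.pushL_apply]
  by_cases h : i < n
  · simp [h, ctxD]
  · simp [h, ctxD]

/-- **`⊢ brGoto j : Dst ⊸ ⋯ ⊸ Dst ⊸ St^{nK+1} ⊗ E_{H+1}`.** [cite: GaboardiMarionRonchidellarocca2008, §3.2 (`Com`)] -/
theorem _root_.Literature.Computability.ImplicitComplexity.STA.HTz.brGoto (hr : 2 ≤ r) (FP : List _) (j : ℕ) :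
    HTz r m k (fun _ => none) (brGoto NS nK FP j) ⟨0, BrR NS nK FP.length⟩ := by
  unfold Sim.brGoto Sim.BrR
  suffices h : HTz r m (k + (nK + 1)) (ctxD NS (nK + 1)) (gotoBody NS nK FP j fun i => .var (nK - i)) ⟨0, BodyT nK FP.length⟩ by
    have := HTz.lamsL (L := fun _ => none) (List.replicate (nK + 1) (⟨0, Dst NS⟩ : SoftTy))
      (by rw [pushL_replicate_Dst, List.length_replicate]; exact h)
    rwa [List.length_replicate] at this
  -- the tuple of restored stacks and the program counter
  refine HTz.tuple hr (fun s => if s < nK + 1 then nK - s else nK + 2) _ _ (by simp) fun c hc => ?_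
  simp only [List.length_append, List.length_map, List.length_range, List.length_cons, List.length_nil] at hc
  by_cases hc' : c < nK + 1
  · have e1 : (((List.range (nK + 1)).map fun i => restore NS (Term.var (nK - i))) ++ [pcT FP.length j]).get ⟨c, by simpa using hc⟩ =
        restore NS (.var (nK - c)) := by
      simp [List.getElem_append_left, hc']
    have e2 : (List.replicate (nK + 1) St ++ [tyE (FP.length + 1)]).get ⟨c, by simpa using hc⟩ = St := by
      simp [List.getElem_append_left, hc']
    rw [e1, e2]
    refine HTz.restore hr (by omega) ?_
    simp [ctxD, show nK - c < nK + 1 by omega, show nK - (nK - c) = c by omega]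
  · have hc2 : c = nK + 1 := by omega
    subst hc2
    have e1 : (((List.range (nK + 1)).map fun i => restore NS (Term.var (nK - i))) ++ [pcT FP.length j]).get
        ⟨nK + 1, by simp⟩ = pcT FP.length j := by
      simp [List.getElem_append_right]
    have e2 : (List.replicate (nK + 1) St ++ [tyE (FP.length + 1)]).get ⟨nK + 1, by simp⟩ = tyE (FP.length + 1) := by
      simp [List.getElem_append_right]
    rw [e1, e2]
    exact HTz.pcT _ _

/-- Promoting a one-slot local context. [folklore] -/
theorem iterate_bang_slot (c p n : ℕ) (A : LinTy) :
    Ctx.bang^[n] (fun s => if s = c then some (⟨p, A⟩ : SoftTy) else none) = fun s => if s = c then some ⟨p + n, A⟩ else none := by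
  induction n with
  | zero => rfl
  | succ n ih =>
    rw [Function.iterate_succ_apply', ih]
    funext s
    by_cases h : s = c <;> simp [Ctx.bang, h, SoftTy.bang, Nat.add_assoc]

/-- **`⊢ brPush k a j : Dst ⊸ ⋯ ⊸ Dst ⊸ St^{nK+1} ⊗ E_{H+1}`** (`k < nK`, `a < NS`).
[cite: GaboardiMarionRonchidellarocca2008, §3.2 (`Com`)] -/
theorem _root_.Literature.Computability.ImplicitComplexity.STA.HTz.brPush (hr : 2 ≤ r) (FP : List _) {k' a : ℕ}
    (hk : k' < nK) (ha : a < NS) (j : ℕ) :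
    HTz r m k (fun _ => none) (brPush NS nK FP k' a j) ⟨0, BrR NS nK FP.length⟩ := by
  unfold Sim.brPush Sim.BrR
  suffices h : HTz r m (k + (nK + 1)) (ctxD NS (nK + 1))
      (Term.letT 3 (.var 0) (pushBody NS nK FP k' a j (fun i => .var (nK - i + 3)) (.var 2) (.var 1))) ⟨0, BodyT nK FP.length⟩ by
    have := HTz.lamsL (L := fun _ => none) (List.replicate (nK + 1) (⟨0, Dst NS⟩ : SoftTy))
      (by rw [pushL_replicate_Dst, List.length_replicate]; exact h)
    rwa [List.length_replicate] at this
  -- `let D_{nK} be g, h, i in …`: the reservoir is slot `0`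
  refine HTz.letT hr (L₁ := fun s => if s = 0 then some ⟨0, Dst NS⟩ else none)
    (L₂ := fun s => if s = 0 then none else ctxD NS (nK + 1) s) (As := [St, X NS, SymT NS]) (fun s => ?_)
    (HTz.lvar (by omega) (by simp [Dst])) ?_
  · by_cases h0 : s = 0
    · subst h0; left; simp [ctxD]
    · right; simp [h0]
  · show HTz r m (k + (nK + 1) + 3) _ _ _
    simp only [List.map_cons, List.map_nil, Ctx.pushL_cons, Ctx.pushL_nil]
    -- the context: `0 ↦ Sym (i_r), 1 ↦ X (h_r), 2 ↦ St (g_r), 3 ↦ none, s = nK - i + 3 ↦ Dst (D_i, i < nK)`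
    refine HTz.tuple hr (fun s => if s = 1 then k' else if s = 2 then nK else if s = 0 then nK
      else if s < nK + 4 then nK + 3 - s else nK + 2) _ _ (by simp) fun c hc => ?_
    simp only [List.length_append, List.length_map, List.length_range, List.length_cons, List.length_nil] at hc
    by_cases hc1 : c < nK + 1
    · have e2 : (List.replicate (nK + 1) St ++ [tyE (FP.length + 1)]).get ⟨c, by simpa using hc⟩ = St := by
        simp [List.getElem_append_left, hc1]
      rw [e2]
      have e1 : ∀ f : ℕ → Term, (((List.range (nK + 1)).map f) ++ [pcT FP.length j]).get ⟨c, by simpa using hc⟩ = f c := by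
        intro f; simp [List.getElem_append_left, hc1]
      rw [e1]
      by_cases hck : c = k'
      · -- the pushed stack `λz. h_r a (restore D_k z)`, in the clean context `h_r : X, D_k : Dst`
        subst hck
        simp only [if_true]
        have hder : HTz r m (k + (nK + 1) + 3)
            (fun s => if s = 1 then some ⟨0, X NS⟩ else if s = nK - c + 3 then some ⟨0, Dst NS⟩ else none)
            (.lam (.app (.app ((Term.var 1).rename Nat.succ) (symT NS a))
              (.app ((restore NS (.var (nK - c + 3))).rename Nat.succ) (.var 0)))) ⟨0, St⟩ := by
          refine HTz.lam (τ := ⟨0, .tvar 0⟩) ?_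
          refine HTz.app hr (q := 0) (B := .tvar 0) (L₁ := fun s => if s = 2 then some ⟨0, X NS⟩ else none)
            (L₂ := fun s => if s = 0 then some ⟨0, .tvar 0⟩ else if s = nK - c + 4 then some ⟨0, Dst NS⟩ else none)
            (fun s => ?_) ?_ ?_
          · rcases s with _ | t
            · right; simp [Ctx.cons]
            · by_cases ht : t = 1
              · subst ht; left; simp [Ctx.cons]
              · by_cases ht' : t = nK - c + 3
                · subst ht'; right; simp [Ctx.cons]
                · left; simp [Ctx.cons, ht, ht']
          · exact (HTz.lvar (A := X NS) (i := 2) (by omega) (by simp)).app_closed_arg (q := 0) (B := SymT NS) (A := St)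
              (HT.oneHot (by omega))
          · refine HTz.app hr (q := 0) (B := .tvar 0) (L₁ := fun s => if s = nK - c + 4 then some ⟨0, Dst NS⟩ else none)
              (L₂ := fun s => if s = 0 then some ⟨0, .tvar 0⟩ else none) (fun s => ?_) ?_ (HTz.lvar (by omega) (by simp))
            · by_cases hs : s = 0
              · subst hs; right; simp
              · left; simp [hs]
            · have h1 := (HTz.restore (NS := NS) hr (r := r) (m := m) (k := k + (nK + 1) + 3) (d := nK - c + 3)
                (L := fun s => if s = nK - c + 3 then some ⟨0, Dst NS⟩ else none) (by omega) (by simp)).shift_succ none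
              refine h1.congrL fun s _ => ?_
              rcases s with _ | s
              · simp [Ctx.cons]
              · simp only [Ctx.cons]
                by_cases hs : s = nK - c + 3
                · simp [hs]
                · simp [hs]
        refine hder.congrL fun s _ => ?_
        rcases s with _ | _ | _ | s
        · simp [Ctx.cons]; omega
        · simp [Ctx.cons]
        · simp [Ctx.cons]; omega
        · simp only [show s + 1 + 1 + 1 ≠ 1 by omega, show s + 1 + 1 + 1 ≠ 2 by omega, show s + 1 + 1 + 1 ≠ 0 by omega,
            if_false, show (s + 1 + 1 + 1 < nK + 4) ↔ (s < nK + 1) by omega,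
            show nK + 3 - (s + 1 + 1 + 1) = nK - s by omega, show (s + 1 + 1 + 1 = nK - c + 3) ↔ (s = nK - c) by omega, Ctx.cons]
          by_cases hs : s = nK - c
          · subst hs
            simp [show nK - c < nK + 1 by omega, show nK - (nK - c) = c by omega, ctxD, show nK - c ≠ 0 by omega]
          · have : ¬(s < nK + 1 ∧ nK - s = c) := fun h => hs (by omega)
            by_cases hs1 : s < nK + 1
            · simp [hs, hs1, show nK - s ≠ c by omega]
            · simp [hs, hs1, show nK + 2 ≠ c by omega]
      · by_cases hcn : c = nK
        · subst hcn
          simp only [hck, if_false, if_true]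
          exact HTz.lvar (by omega) (by simp [Ctx.cons])
        · simp only [hck, hcn, if_false]
          refine HTz.restore hr (by omega) ?_
          have h4 : 4 ≤ nK - c + 3 := by omega
          simp only [show nK - c + 3 ≠ 1 by omega, show nK - c + 3 ≠ 2 by omega, show nK - c + 3 ≠ 0 by omega, if_false,
            show nK - c + 3 < nK + 4 by omega, if_true, show nK + 3 - (nK - c + 3) = c by omega]
          obtain ⟨d, hd⟩ : ∃ d, nK - c + 3 = d + 3 := ⟨nK - c, rfl⟩
          rw [hd]
          simp [Ctx.cons, show d ≠ 0 by omega, ctxD, show d < nK + 1 by omega]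
    · have hc2 : c = nK + 1 := by omega
      subst hc2
      have e1 : ∀ f : ℕ → Term, (((List.range (nK + 1)).map f) ++ [pcT FP.length j]).get ⟨nK + 1, by simp⟩ = pcT FP.length j := by
        intro f; simp [List.getElem_append_right]
      have e2 : (List.replicate (nK + 1) St ++ [tyE (FP.length + 1)]).get ⟨nK + 1, by simp⟩ = tyE (FP.length + 1) := by
        simp [List.getElem_append_right]
      rw [e1, e2]
      exact HTz.pcT _ _

/-- **`⊢ brPop k t : Dst ⊸ ⋯ ⊸ Dst ⊸ St^{nK+1} ⊗ E_{H+1}`** (`k < nK`).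
[cite: GaboardiMarionRonchidellarocca2008, §3.2 (`Com`, `δ`)] -/
theorem _root_.Literature.Computability.ImplicitComplexity.STA.HTz.brPop (hr : 2 ≤ r) (FP : List _) {k' : ℕ}
    (hk : k' < nK) (t : List ℕ) :
    HTz r m k (fun _ => none) (brPop NS nK FP k' t) ⟨0, BrR NS nK FP.length⟩ := by
  unfold Sim.brPop Sim.BrR
  suffices h : HTz r m (k + (nK + 1)) (ctxD NS (nK + 1))
      (Term.letT 3 (.var (nK - k')) (popBody NS nK FP k' t (fun i => .var (nK - i + 3)) (.var 2) (.var 0))) ⟨0, BodyT nK FP.length⟩ by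
    have := HTz.lamsL (L := fun _ => none) (List.replicate (nK + 1) (⟨0, Dst NS⟩ : SoftTy))
      (by rw [pushL_replicate_Dst, List.length_replicate]; exact h)
    rwa [List.length_replicate] at this
  -- `let D_k be g, h, i in …`
  refine HTz.letT hr (L₁ := fun s => if s = nK - k' then some ⟨0, Dst NS⟩ else none)
    (L₂ := fun s => if s = nK - k' then none else ctxD NS (nK + 1) s) (As := [St, X NS, SymT NS]) (fun s => ?_)
    (HTz.lvar (by omega) (by simp [Dst])) ?_
  · by_cases h0 : s = nK - k'
    · subst h0; left; simp [ctxD]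
    · right; simp [h0]
  · show HTz r m (k + (nK + 1) + 3) _ _ _
    simp only [List.map_cons, List.map_nil, Ctx.pushL_cons, Ctx.pushL_nil]
    -- the context: `0 ↦ Sym (i), 1 ↦ X (h, unused), 2 ↦ St (g), s = nK - i + 3 ↦ Dst (D_i, i ≠ k)`
    refine HTz.tuple hr (fun s => if s = 2 then k' else if s < 3 then nK + 1
      else if s < nK + 4 then nK + 3 - s else nK + 2) _ _ (by simp) fun c hc => ?_
    simp only [List.length_append, List.length_map, List.length_range, List.length_cons, List.length_nil] at hc
    by_cases hc1 : c < nK + 1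
    · have e2 : (List.replicate (nK + 1) St ++ [tyE (FP.length + 1)]).get ⟨c, by simpa using hc⟩ = St := by
        simp [List.getElem_append_left, hc1]
      rw [e2]
      have e1 : ∀ (f : ℕ → Term) (P : Term), (((List.range (nK + 1)).map f) ++ [P]).get ⟨c, by simpa using hc⟩ = f c := by
        intro f P; simp [List.getElem_append_left, hc1]
      rw [e1]
      by_cases hck : c = k'
      · subst hck
        simp only [if_true]
        exact HTz.lvar (by omega) (by simp [Ctx.cons])
      · simp only [hck, if_false]
        refine HTz.restore hr (by omega) ?_
        obtain ⟨d, hd⟩ : ∃ d, nK - c + 3 = d + 3 := ⟨nK - c, rfl⟩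
        rw [hd]
        have hd' : d ≠ nK - k' := by omega
        simp [Ctx.cons, show d + 3 ≠ 2 by omega, show d + 3 < nK + 4 by omega, show nK + 3 - (d + 3) = c by omega, hd', ctxD,
          show d < nK + 1 by omega]
    · have hc2 : c = nK + 1 := by omega
      subst hc2
      have e1 : ∀ (f : ℕ → Term) (P : Term), (((List.range (nK + 1)).map f) ++ [P]).get ⟨nK + 1, by simp⟩ = P := by
        intro f P; simp [List.getElem_append_right]
      have e2 : (List.replicate (nK + 1) St ++ [tyE (FP.length + 1)]).get ⟨nK + 1, by simp⟩ = tyE (FP.length + 1) := by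
        simp [List.getElem_append_right]
      rw [e1, e2]
      -- the popped symbol reads the table
      refine HTz.caseE hr (tyE (FP.length + 1)) (n := NS + 1) (HTz.lvar (by omega) ?_) (by simp) fun j hj => ?_
      · simp [Ctx.cons, SymT]
      · simp only [List.get_eq_getElem, List.getElem_map, List.getElem_range]
        exact HTz.pcT _ _

/-- **The branch of every instruction is typed** (push symbols `< NS`).
[cite: GaboardiMarionRonchidellarocca2008, §3.2] -/
theorem _root_.Literature.Computability.ImplicitComplexity.STA.HTz.brInstr (hr : 2 ≤ r) {FP : List _}
    (hFP : ProgSymOK NS FP) (pc : ℕ) :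
    HTz r m k (fun _ => none) (brInstr NS nK FP FP[pc]?) ⟨0, BrR NS nK FP.length⟩ := by
  rcases hI : FP[pc]? with _ | ⟨j⟩ | ⟨k', a, j⟩ | ⟨k', t⟩ <;> simp only [Sim.brInstr]
  · exact HTz.brGoto hr FP _
  · exact HTz.brGoto hr FP _
  · by_cases hk : k' < nK
    · rw [if_pos hk]; exact HTz.brPush hr FP hk (hFP _ _ _ _ hI) j
    · rw [if_neg hk]; exact HTz.brGoto hr FP _
  · by_cases hk : k' < nK
    · rw [if_pos hk]; exact HTz.brPop hr FP hk t
    · rw [if_neg hk]; exact HTz.brGoto hr FP _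

/-- The context `f₀ … f_{nK} : Dst ⊸ Dst, p : E_{H+1}` of the continuation of `Step`. [folklore] -/
def ctxS (NS nK H : ℕ) : Ctx := fun s =>
  if s = 0 then some ⟨0, tyE (H + 1)⟩ else if s < nK + 2 then some ⟨0, .limp 0 (Dst NS) (Dst NS)⟩ else none

/-- `pushL_stepAs` (bookkeeping). [folklore] -/
theorem pushL_stepAs (H : ℕ) :
    Ctx.pushL ((List.replicate (nK + 1) (LinTy.limp 0 (Dst NS) (Dst NS)) ++ [tyE (H + 1)]).map fun A => (⟨0, A⟩ : SoftTy))
      (fun _ => none) = ctxS NS nK H := by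
  funext s
  rw [Ctx.pushL_apply]
  simp only [List.length_map, List.length_append, List.length_replicate, List.length_cons, List.length_nil]
  by_cases h : s < nK + 1 + (0 + 1)
  · rw [dif_pos h]
    by_cases h0 : s = 0
    · subst h0
      simp [ctxS, List.getElem_append_right]
    · simp [ctxS, h0, show s < nK + 2 by omega]
      rw [List.getElem_append_left (by simp; omega)]
      simp
  · rw [dif_neg h]
    simp [ctxS, show s ≠ 0 by omega, show ¬(s < nK + 2) by omega]

/-- **The continuation `(p BRS) (f₀ initD) ⋯ (f_{nK} initD) : St^{nK+1} ⊗ E_{H+1}`.**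
[cite: GaboardiMarionRonchidellarocca2008, §3.2] -/
theorem _root_.Literature.Computability.ImplicitComplexity.STA.HTz.stepBody (hr : 2 ≤ r) {FP : List _} (hFP : ProgSymOK NS FP)
    {K : ℕ} (hK : nK + 2 ≤ K) : HTz r m K (ctxS NS nK FP.length) (stepBody NS nK FP) ⟨0, BodyT nK FP.length⟩ := by
  unfold Sim.stepBody
  refine HTz.appsOwn hr (fun s => if s = 0 then 0 else nK + 2 - s) _ (σs := List.replicate (nK + 1) ⟨0, Dst NS⟩) (by simp) ?_
    fun j hj => ?_
  · -- the dispatch `p BRS`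
    refine HTz.caseE hr (BrR NS nK FP.length) (n := FP.length + 1) (HTz.lvar (by omega) (by simp [ctxS])) length_BRS fun j hj => ?_
    simp only [BRS, List.get_eq_getElem, List.getElem_map, List.getElem_range]
    exact HTz.brInstr hr hFP j
  · simp only [List.length_map, List.length_range] at hj
    simp only [List.get_eq_getElem, List.getElem_map, List.getElem_range, List.getElem_replicate]
    refine HTz.app hr (q := 0) (B := Dst NS) (L₂ := fun _ => none) (fun s => Or.inl ⟨rfl, rfl⟩) (HTz.lvar (by omega) ?_)
      (HTz.initD hr)
    simp [ctxS, show nK + 1 - j ≠ 0 by omega, show nK + 2 - (nK + 1 - j) = j + 1 by omega, show nK + 1 - j < nK + 2 by omega]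

/-- **`⊢ Step : Conf ⊸ Conf`** for every pair of constructor levels `m₁, p₂` (GMR: "`Tr : ATM_i ⊸
ATM_i` for every `i`"). [cite: GaboardiMarionRonchidellarocca2008, §3.2, Thm. 3.9] -/
theorem _root_.Literature.Computability.ImplicitComplexity.STA.HTz.Step (hr : 2 ≤ r) {FP : List _} (hFP : ProgSymOK NS FP)
    (m₁ p₂ : ℕ) :
    HTz r m k L (Sim.Step NS nK FP) ⟨0, .limp 0 (Conf NS nK FP.length m₁ p₂) (Conf NS nK FP.length m₁ p₂)⟩ := by
  refine HTz.weakenL (L := fun _ => none) ?_ (fun i _ h => absurd rfl h)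
  show HTz r m k (fun _ => none) (.lam (.lam (.lam _))) _
  refine HTz.lam (τ := ⟨0, Conf NS nK FP.length m₁ p₂⟩) (HTz.allI ?_)
  have hsh : (Ctx.cons (some ⟨0, Conf NS nK FP.length m₁ p₂⟩) (fun _ => none : Ctx)).shift =
      Ctx.cons (some ⟨0, Conf NS nK FP.length m₁ p₂⟩) (fun _ => none) := by
    funext s
    cases s with
    | zero => simp [Ctx.shift, Ctx.cons, SoftTy.shift, Conf_rename]
    | succ s => rfl
  rw [hsh]
  refine HTz.lam (τ := ⟨m₁, X NS⟩) (HTz.lam (τ := ⟨p₂, X NS⟩) ?_)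
  -- `let (s F[c₁] F[c₂]) be f⃗, p in stepBody`
  have hAs : (List.replicate (nK + 1) (LinTy.limp 0 (Dst NS) (Dst NS)) ++ [tyE (FP.length + 1)]).length = nK + 2 := by simp
  have key := HTz.letT hr (r := r) (m := m) (k := k + 1 + 1 + 1)
    (L := Ctx.cons (some ⟨p₂, X NS⟩) (Ctx.cons (some ⟨m₁, X NS⟩) (Ctx.cons (some ⟨0, Conf NS nK FP.length m₁ p₂⟩) fun _ => none)))
    (L₁ := Ctx.cons (some ⟨p₂, X NS⟩) (Ctx.cons (some ⟨m₁, X NS⟩) (Ctx.cons (some ⟨0, Conf NS nK FP.length m₁ p₂⟩) fun _ => none)))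
    (L₂ := fun _ => none) (p := (Term.var 2).apps [F NS (.var 1), F NS (.var 0)]) (R := stepBody NS nK FP)
    (As := List.replicate (nK + 1) (LinTy.limp 0 (Dst NS) (Dst NS)) ++ [tyE (FP.length + 1)]) (C := BodyT nK FP.length)
    (fun s => Or.inl ⟨rfl, rfl⟩) ?_ ?_
  · rwa [hAs] at key
  · -- `s [Dst] F[c₁] F[c₂]`
    have hs : HTz r m (k + 1 + 1 + 1) (fun s => if s = 2 then some ⟨0, Conf NS nK FP.length m₁ p₂⟩ else none) (.var 2)
        ⟨0, .limp m₁ (XD NS (Dst NS)) (.limp p₂ (XD NS (Dst NS)) (BodyTD nK FP.length (Dst NS)))⟩ := by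
      have := (HTz.lvar (r := r) (m := m) (k := k + 1 + 1 + 1)
        (L := fun s => if s = 2 then some ⟨0, Conf NS nK FP.length m₁ p₂⟩ else none) (i := 2) (by omega)
        (A := Conf NS nK FP.length m₁ p₂) (by simp)).allE (Dst NS)
      rwa [confBody_inst] at this
    refine HTz.appsOwn hr (fun s => if s = 2 then 0 else if s = 1 then 1 else 2) [F NS (.var 1), F NS (.var 0)]
      (σs := [⟨m₁, XD NS (Dst NS)⟩, ⟨p₂, XD NS (Dst NS)⟩]) rfl (hs.congrL fun s _ => ?_) fun j hj => ?_
    · rcases s with _ | _ | _ | s <;> simp [Ctx.cons]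
    · rcases j with _ | _ | j
      · -- `F[c₁]` boxed `m₁` times
        have h1 := (HTz.F (NS := NS) hr (r := r) (m := m) (k := k + 1 + 1 + 1)
          (L := fun s => if s = 1 then some ⟨0, X NS⟩ else none) (HTz.lvar (i := 1) (by omega) (by simp))).boxN m₁
        rw [iterate_bang_slot, Nat.zero_add] at h1
        refine h1.congrL fun s _ => ?_
        rcases s with _ | _ | _ | s <;> simp [Ctx.cons]
      · have h1 := (HTz.F (NS := NS) hr (r := r) (m := m) (k := k + 1 + 1 + 1)
          (L := fun s => if s = 0 then some ⟨0, X NS⟩ else none) (HTz.lvar (i := 0) (by omega) (by simp))).boxN p₂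
        rw [iterate_bang_slot, Nat.zero_add] at h1
        refine h1.congrL fun s _ => ?_
        rcases s with _ | _ | _ | s <;> simp [Ctx.cons]
      · simp at hj
  · rw [pushL_stepAs, hAs]
    exact HTz.stepBody hr hFP (by omega)

end typing



end Sim

end STA

end Literature.Computability.ImplicitComplexity
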